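import Literature.NumberTheory.EllipticCurves.Phi64QExpansion
import Literature.NumberTheory.EllipticCurves.CongruentPhiQuarterTranslation
import Literature.NumberTheory.EllipticCurves.CuspFormLFunction
import HarnessLib

/-!
# The congruent-number newform `φ = Θ′·(2θ₁₆ - θ₄)` as a `CuspForm (Γ₀(64)) 2` with `L(φ, s) = L(E, s)`

The weight-`2` input of the Shintani-lift route to
`Literature.NumberTheory.EllipticCurves.Tunnell1983_a_sq_propto_L_one` (odd case; the lift
`Shintani.shintaniLift D (f : CuspForm (Gamma0 64) 2)` of `ShintaniLift` takes a cusp form ON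
`Γ₀(64)`): the newform `φ = η(4z)²η(8z)² = q - 2q⁵ - 3q⁹ + 6q¹³ + …` of `E : y² = x³ - x` (level
`32`), realised at level `64`. `CongruentNewformThetaProofs` constructed `φ = congruentPhi =
(2gθ₃₂ - gθ₈)(2θ₁₆ - θ₄)` inside `S_{4/2}(128, 1)` and proved `aₙ(φ) = aₙ(E)`; here we PROVE the
sharper level:

* `two_thirtytwo_sub_eight_eq_half_thetaChi` — `2gθ₃₂ - gθ₈ = ½ Θ′` (`Θ′ = ∑ χ₋₄(n) n e(n²z)`,
  `ThetaChiFour`; by `two_thirtytwo_sub_eight_eq_half_theta1'` and the sibling's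
  `thetaChi_eq_theta1'_eight`), hence `congruentPhi_eq_thetaChi` — **`φ = ½ Θ′ (2θ₁₆ - θ₄)`** and
  `congruentPhi_eq_thetaChi_mul_sub_phi64` — `φ = Θ′θ₁₆ - φ₆₄` (`φ₆₄ = ½Θ′θ₄`, the newform of `64a`);
* `thetaMul_sixteen_mem_halfIntModularForms_64` — `θ₁₆ ∈ M_{1/2}(64, 1)` (as the sibling's `θ₄`);
* `congruentPhi_mem_64` — **`φ ∈ S_{4/2}(64, 1)`** (`Θ′ ∈ S_{3/2}(64, 1)`, `Phi64`), and
  **`congruentCuspForm : CuspForm (Gamma0 64) 2`** (the tree's `cuspFormTwoOfMem`) with function `φ`;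
* `cuspCoeff_congruentCuspForm_eq_lFunction` — **`aₙ(φ) = aₙ(E)` for ALL `n`**;
  `cuspFormLSeries_congruentCuspForm` — `L(φ, s) = L(E, s)`; `cuspCoeff_congruentCuspForm_one` — `a₁ = 1`;
* `lFunction_congruentNumberCurve_eq_jacobiSym_mul_cuspCoeff` — **`aₙ(E_m) = (m/n)·aₙ(φ)`** for
  square-free `m`, all `n` (the quadratic twists `E_m : y² = x³ - m²x`);
* `modularSymbol_congruentCuspForm_eq`, `modularSymbol_congruentCuspForm_add_quarter` — the level-`64`
  form has the same modular symbols as the sibling's level-`128` `Shintani.congruentPhiCuspForm`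
  (`CongruentPhiQuarterTranslation`), in particular `{∞, r + 1/4}_φ = i{∞, r}_φ`.

No named facts; the only definition is `congruentCuspForm`.

## References

* J. B. Tunnell, Invent. Math. 72 (1983), p. 325 (`φ`, `L(E^D, s) = L(φ ⊗ χ_D, s)`). [Tunnell1983Congruent]
* G. Shimura, *On modular forms of half integral weight*, Ann. of Math. 97 (1973), §1–§2. [Shimura1973HalfIntegral]
-/

noncomputable section

open scoped MatrixGroups ModularForm NumberTheorySymbols
open CongruenceSubgroup

namespace Literature.NumberTheory.EllipticCurves.Tunnell1983

open Literature.NumberTheory.EllipticCurves.ModularForms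
open Literature.NumberTheory.EllipticCurves.JacobiThetaNull

/-! ### `φ = ½ Θ′ (2θ₁₆ - θ₄)` -/

/-- **`2gθ₃₂ - gθ₈ = ½ Θ′`.** [cite: Tunnell1983Congruent, p. 327] -/
theorem two_thirtytwo_sub_eight_eq_half_thetaChi (z : UpperHalfPlane) :
    2 * tunnellForm 32 z - tunnellForm 8 z = (1 / 2 : ℂ) * thetaChi z := by
  rw [two_thirtytwo_sub_eight_eq_half_theta1', thetaChi_eq_theta1'_eight]

/-- **`φ = ½ Θ′ · (2θ₁₆ - θ₄)`.** [cite: Tunnell1983Congruent, p. 325] -/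
theorem congruentPhi_eq_thetaChi (z : UpperHalfPlane) :
    congruentPhi z = (1 / 2 : ℂ) * thetaChi z * (2 * thetaMul 16 z - thetaMul 4 z) := by
  rw [congruentPhi, two_thirtytwo_sub_eight_eq_half_thetaChi]

/-- `φ = Θ′θ₁₆ - φ₆₄` (`φ₆₄ = ½ Θ′ θ₄`, the newform of `64a`). [folklore] -/
theorem congruentPhi_eq_thetaChi_mul_sub_phi64 (z : UpperHalfPlane) :
    congruentPhi z = thetaChi z * thetaMul 16 z - phi64 z := by
  rw [congruentPhi_eq_thetaChi, phi64]
  ring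

/-! ### Level `64` -/

/-- `θ₁₆` is theta-automorphic of weight `1/2`, level `64`, trivial character
(`θ₁₆(γz) = j(γ,z) θ₁₆(z)` for `64 ∣ c`, `(16/|d|) = 1`). [cite: Shimura1973HalfIntegral, §2] -/
theorem isThetaAutomorphic_thetaMul_sixteen_64 : IsThetaAutomorphic 1 64 1 (thetaMul 16) := by
  intro γ hγ z
  have h64 : (64 : ℤ) ∣ γ 1 0 := by
    have h0 : ((γ 1 0 : ℤ) : ZMod 64) = 0 := Gamma0_mem.mp hγ
    exact (ZMod.intCast_zmod_eq_zero_iff_dvd _ 64).mp h0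
  have hγ4 : γ ∈ Gamma0 4 := mem_Gamma0_four_of_dvd (by norm_num) hγ
  have hd : Odd (γ 1 1 : ℤ) := odd_d_of_mem_Gamma0 hγ4
  rw [thetaMul_smul (by norm_num : 0 < 16) ((show (4 * 16 : ℤ) ∣ 64 by norm_num).trans h64) z,
    shimuraTheta_smul_eq_thetaFactor (by norm_num : 4 ∣ 64) hγ z,
    MulChar.one_apply (isUnit_zmod64_of_odd hd),
    jacobiSym_eq_one_of_sq (Or.inr (Or.inr rfl)) (Int.natAbs_odd.mpr hd)]
  push_cast
  ring

/-- **`θ₁₆ ∈ M_{1/2}(64, 1)`.** [cite: Shimura1973HalfIntegral, §2] -/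
theorem thetaMul_sixteen_mem_halfIntModularForms_64 : thetaMul 16 ∈ halfIntModularForms 1 64 1 :=
  ⟨mdifferentiable_thetaMul (by norm_num), isThetaAutomorphic_thetaMul_sixteen_64,
    isBoundedAtImInfty_slashSq_thetaMul (by norm_num)⟩

/-- **`φ ∈ S_{4/2}(64, 1) = S₂(Γ₀(64))`.** [cite: Tunnell1983Congruent, p. 325] -/
theorem congruentPhi_mem_64 : congruentPhi ∈ halfIntCuspForms 4 64 1 := by
  have hθ : (2 : ℂ) • thetaMul 16 - thetaMul 4 ∈ halfIntModularForms 1 64 1 :=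
    Submodule.sub_mem _ (Submodule.smul_mem _ _ thetaMul_sixteen_mem_halfIntModularForms_64)
      thetaMul_four_mem_halfIntModularForms_64
  have h := mul_mem_halfIntCuspForms thetaChi_mem_halfIntCuspForms hθ
  rw [one_mul_one_dirichlet] at h
  have h2 := (halfIntCuspForms 4 64 1).smul_mem (1 / 2 : ℂ) h
  convert h2 using 1
  funext z
  simp only [Pi.smul_apply, Pi.mul_apply, Pi.sub_apply, smul_eq_mul, congruentPhi_eq_thetaChi]
  ring

/-- **The congruent-number newform as a weight-`2` cusp form on `Γ₀(64)`.** [cite: Tunnell1983Congruent, p. 325] -/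
def congruentCuspForm : CuspForm (Gamma0 64) 2 :=
  cuspFormTwoOfMem (N := 64) (by norm_num) congruentPhi congruentPhi_mem_64

/-- Its function is `φ`. [folklore] -/
@[simp] theorem congruentCuspForm_apply (z : UpperHalfPlane) : congruentCuspForm z = congruentPhi z := rfl

/-- `⇑congruentCuspForm = congruentPhi`. [folklore] -/
theorem coe_congruentCuspForm : ⇑congruentCuspForm = congruentPhi := rfl

/-! ### Coefficients and `L`-series -/

/-- `aₙ(congruentCuspForm) = qCoeffs congruentPhi n` (same `q`-expansion). [folklore] -/
theorem cuspCoeff_congruentCuspForm (n : ℕ) : cuspCoeff congruentCuspForm n = qCoeffs congruentPhi n := rfl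

/-- `a₀(φ) = 0` (`Re S(0) = 0`). [folklore] -/
theorem qCoeffs_congruentPhi_zero : qCoeffs congruentPhi 0 = 0 := by
  rw [qCoeffs_congruentPhi]
  simp [QuadraticFields.GaussianPrimary.primarySum_of_even (dvd_zero 2)]

/-- **`aₙ(φ) = aₙ(E)` for all `n`** (`E = congruentNumberCurve 1 : y² = x³ - x`).
[cite: Tunnell1983Congruent, p. 325] -/
theorem cuspCoeff_congruentCuspForm_eq_lFunction (n : ℕ) :
    cuspCoeff congruentCuspForm n = ((congruentNumberCurve 1).LFunction n : ℂ) := by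
  rcases eq_or_ne n 0 with rfl | hn
  · rw [cuspCoeff_congruentCuspForm, qCoeffs_congruentPhi_zero, ArithmeticFunction.map_zero, Int.cast_zero]
  · rw [cuspCoeff_congruentCuspForm, qCoeffs_congruentPhi_eq_lFunction hn]

/-- `a₁(φ) = 1`: `φ` is normalised. [folklore] -/
theorem cuspCoeff_congruentCuspForm_one : cuspCoeff congruentCuspForm 1 = 1 := by
  rw [cuspCoeff_congruentCuspForm_eq_lFunction, (congruentNumberCurve 1).isMultiplicative_LFunction.map_one,
    Int.cast_one]

/-- **`L(φ, s) = L(E, s)`** for every `s`. [cite: Tunnell1983Congruent, p. 325] -/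
theorem cuspFormLSeries_congruentCuspForm (s : ℂ) :
    cuspFormLSeries congruentCuspForm s = (congruentNumberCurve 1).LSeries s := by
  unfold cuspFormLSeries WeierstrassCurve.LSeries
  congr 1
  funext n
  exact cuspCoeff_congruentCuspForm_eq_lFunction n

/-- **`aₙ(E_m) = (m/n) · aₙ(φ)`** for square-free `m` and all `n`.
[cite: Tunnell1983Congruent, p. 325 ("`L(Eᴰ, s)` is the Mellin transform of `φ ⊗ χ_D`")] -/
theorem lFunction_congruentNumberCurve_eq_jacobiSym_mul_cuspCoeff {m : ℕ} (hm : Squarefree m) (n : ℕ) :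
    ((congruentNumberCurve m).LFunction n : ℂ) = (jacobiSym m n : ℂ) * cuspCoeff congruentCuspForm n := by
  rcases eq_or_ne n 0 with rfl | hn
  · rw [cuspCoeff_congruentCuspForm, qCoeffs_congruentPhi_zero, ArithmeticFunction.map_zero, Int.cast_zero,
      mul_zero]
  · rw [cuspCoeff_congruentCuspForm]
    exact lFunction_congruentNumberCurve_eq_jacobiSym_mul_qCoeffs hm hn

/-- `aₙ(φ₆₄) = (2/n) aₙ(φ)` — the newform of `64a` is the quadratic twist of `φ` by `(2/·)`
(the sibling's `qCoeffs_phi64_eq_jacobiSym_mul_congruentPhi`, restated for the cusp forms). [folklore] -/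
theorem cuspCoeff_phi64CuspForm (n : ℕ) :
    cuspCoeff phi64CuspForm n = (jacobiSym 2 n : ℂ) * cuspCoeff congruentCuspForm n :=
  qCoeffs_phi64_eq_jacobiSym_mul_congruentPhi n

/-! ### `{∞, r}_φ` at level `64`: same symbols as the sibling's level-`128` packaging -/

/-- The modular symbols of `congruentCuspForm` (level `64`) are those of the sibling's
`Shintani.congruentPhiCuspForm` (level `128`): both have the function `φ`. [folklore] -/
theorem modularSymbol_congruentCuspForm_eq (r : ℚ) :
    modularSymbol congruentCuspForm r = modularSymbol Shintani.congruentPhiCuspForm r := rfl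

/-- **`{∞, r + 1/4}_φ = i · {∞, r}_φ`** for the level-`64` cusp form (the sibling's
`modularSymbol_congruentPhi_add_quarter`, from `φ(z + 1/4) = iφ(z)`). [folklore] -/
theorem modularSymbol_congruentCuspForm_add_quarter (r : ℚ) :
    modularSymbol congruentCuspForm (r + 1 / 4) = Complex.I * modularSymbol congruentCuspForm r := by
  rw [modularSymbol_congruentCuspForm_eq, modularSymbol_congruentCuspForm_eq,
    Shintani.modularSymbol_congruentPhi_add_quarter]

end Literature.NumberTheory.EllipticCurves.Tunnell1983

end
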